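import Summits.QuantumFields.BalabanUV.T4Continuum.Spine.NE2BalabanFinal
import Summits.QuantumFields.BalabanUV.T4Continuum.Support.GaugeTermThreshold
import Summits.QuantumFields.BalabanUV.T4Continuum.Support.RegularTransportSize

/-!
# T⁴ programme, spine node NE2 (U1a), tier B row B7 (ASSEMBLY) — ROOT B's `t = 1` face with ONE EXPLICIT SMALL-FIELD THRESHOLD
# `α, β ≤ η ≤ η⋆(card o, d, a, a′)` (the skeleton's «α₁ ≤ α₁⋆ EXPLICIT» in its literal form)

NE2 formalisation swarm `b2b-balaban-t4-ne2-formalise-*`, leaf prover 08 (row B7 of `t4/formal/NE2/LEAVES.md`, CLAIMS l.5490), PART 2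
file 7.  Inputs BY NAME: `Spine/NE2BalabanFinal.balaban_final_rate_of_small` (leaf-08, file 6 — ROOT B on row data with the numeric binders
`kappaS < 1`, `σ₀⁻²·δK < 1`, `α, β, epsR, κ₄ ≤ η ≤ 1`, `η·KstarR < 1`), `Support/GaugeTermThreshold.gaugeSlot_small_of_le` (leaf-05 GEN 2: the
B4 half of the arithmetic, constants `KB4`, `KG`), `Support/RegularTransportSize` (leaf-03: `e^{(d+1)α} − 1 ≤ 2(d+1)η`),
`Spine/NE2BalabanLayerSharp.KstarR` (leaf-03).

WHAT THIS FILE DOES (real-inequality bookkeeping on OUR constants; changes no mathematics, removes no conditionality).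
* `Kmax o d a a′ = 2·card o·(d+1) + 2(d+1)·KG(d,a,a′) + 1` and **`etaStar o d a a′ = min (1/(2(d+1)(1 + KB4))) (1/(2·Kmax·(KstarR + 1)))`**
  (closed form, `etaStar_pos`);
* **`smallness_of_le`**: `0 ≤ α ≤ η`, `0 ≤ β ≤ η`, `η ≤ η⋆` ⟹ the eight numeric binders of `balaban_final_rate_of_small` with smallness
  parameter `η·Kmax`;
* **`balaban_final_rate_of_regular`**: ROOT B at `t = 1` for Bałaban's typed operator displaying ONLY `hreg : RegularTransporters L M
  (liftR L M Rg) α β` (row B5's (3.35)-shape class), `hNE3 : LocalRate (bgReadings L M (regClass L M (liftR L M Rg))) C L⁻¹` (node NE3 BY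
  NAME, OPEN), `0 < a′`, and `α ≤ η`, `β ≤ η`, `η ≤ etaStar o d a a′`.

HONEST FRAMING (T4-DAG p. 1).  Elementary arithmetic at MODEL LEVEL; `Rg`, `a′` DATA; hypothesis SHAPES; no assertion that `Rg` is
Bałaban's minimiser (no B0, c5); GLOBAL small field; finite torus, linear layer, operator norm; ROOT B CONDITIONAL on node NE3 (OPEN); NOT
[B9] (3.23)–(3.26) as printed; NE2 (U1a) is NOT PROVED by this file (c1 with the carver); spine PROVED count 0/9 unchanged; NOT infinite
volume / mass gap / Clay.  HONEST DEPENDENCY: continuum YM on T⁴ ⇐ BetaPertH ∧ nine spine estimates (0/9 proved); BetaPertH ⇐ (D1) ∧ (D4)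
∧ CAP+tail; G-an2-4 gates asym, D1 and NE2/3/4.  ABSOLUTE RULE: no internally-minted statement enters as a cited fact; no `def … : Prop`
fact; no `sorry`.
-/

noncomputable section

open scoped BigOperators ComplexConjugate Matrix Matrix.Norms.L2Operator Kronecker
open Filter Topology

namespace Summit.QuantumFields.BalabanUV.T4Continuum.NE2BalabanThreshold

open Literature.MathematicalPhysics.QuantumFieldTheory.Balaban1983to89.B5Prop11Plancherel (Cst Cst_nonneg Tor fine)
open Literature.MathematicalPhysics.QuantumFieldTheory.Balaban1983to89.B5G183RateUnitTower (lev lev_neZero)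
open Literature.MathematicalPhysics.QuantumFieldTheory.Balaban1983to89.T4EtaRateMin (LocalRate)
open Summit.QuantumFields.BalabanUV.T4Continuum
open Summit.QuantumFields.BalabanUV.T4Continuum.CovariantAveragingTower (TowerLimitRate)
open Summit.QuantumFields.BalabanUV.T4Continuum.BalabanAveragedTowerUnit (idx Qlev)
open Summit.QuantumFields.BalabanUV.T4Continuum.BackgroundResolventTower
open Summit.QuantumFields.BalabanUV.T4Continuum.KingPairingPlantedLaw
open Summit.QuantumFields.BalabanUV.T4Continuum.GramPerturbationLaw (C2gram)
open Summit.QuantumFields.BalabanUV.T4Continuum.NE2FromNE3 (bgReadings)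
open Summit.QuantumFields.BalabanUV.T4Continuum.RegularBackgroundTower (RegularTransporters regClass betaNE3)
open Summit.QuantumFields.BalabanUV.T4Continuum.GaugeTermPerturbationLaw (deltaK)
open Summit.QuantumFields.BalabanUV.T4Continuum.GaugeTermScalarData (QuT Q1)
open Summit.QuantumFields.BalabanUV.T4Continuum.GaugeTermInstanceGeom (gS kappaGS)
open Summit.QuantumFields.BalabanUV.T4Continuum.GaugeTermThreshold (KB4 KG KS_nonneg K_nonneg Ginv_nonneg gaugeSlot_small_of_le)
open Summit.QuantumFields.BalabanUV.T4Continuum.RegularTransportSize (exp_mul_sub_one_nonneg exp_mul_sub_one_le card_mul_exp_sub_one_le)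
open Summit.QuantumFields.BalabanUV.T4Continuum.ScalarAveragedCompression (sigma0)
open Summit.QuantumFields.BalabanUV.T4Continuum.ScalarCovariantLaplacian (kappaS)
open Summit.QuantumFields.BalabanUV.T4Continuum.RegularSiteTransporters (siteT)
open Summit.QuantumFields.BalabanUV.T4Continuum.NestedContourTransport (theta0)
open Summit.QuantumFields.BalabanUV.T4Continuum.NE2BalabanRoot (balabanPert)
open Summit.QuantumFields.BalabanUV.T4Continuum.NE2BalabanGauge (gaugeSlot liftR)
open Summit.QuantumFields.BalabanUV.T4Continuum.NE2BalabanLayerSharp (kappaBs C2Bs KstarR)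
open Summit.QuantumFields.BalabanUV.T4Continuum.NE2BalabanWiring (epsR CdeltaR)
open Summit.QuantumFields.BalabanUV.T4Continuum.NE2BalabanFinal (tauR kappa4F C4F balaban_final_rate_of_small)

variable {d : ℕ} (L : ℕ) [NeZero L] (M : Fin d → ℕ) [hM : ∀ μ, NeZero (M μ)] (a : ℝ) (ha : 0 < a)
variable {o : Type*} [Fintype o] [DecidableEq o]

/-! ## §1 The explicit threshold -/

/-- the conversion constant from the regularity parameter `η` to the smallness parameter of the `t = 1` face:
`Kmax = 2·card o·(d+1) + 2(d+1)·KG(d,a,a′) + 1`. [folklore] -/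
def Kmax (o : Type*) [Fintype o] (d : ℕ) (a a' : ℝ) : ℝ :=
  2 * Fintype.card o * (d + 1) + 2 * (d + 1) * KG d a a' + 1

/-- **THE EXPLICIT SMALL-FIELD THRESHOLD** `η⋆(card o, d, a, a′) = min (1 / (2(d+1)(1 + KB4(d,a′)))) (1 / (2·Kmax·(KstarR + 1)))`
(closed form: `KB4`, `KG` are leaf-05's polynomials in `γ′⁻¹`, `σ₀⁻²`, `a′`, `d`; `KstarR` leaf-03's `7(card o)²dCst + 3aCst + 1`). [folklore] -/
def etaStar (o : Type*) [Fintype o] (d : ℕ) (a a' : ℝ) : ℝ :=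
  min (1 / (2 * ((d : ℝ) + 1) * (1 + KB4 d a'))) (1 / (2 * Kmax o d a a' * (KstarR o d a + 1)))

omit [DecidableEq o] in
/-- `0 ≤ KG`. [folklore] -/
theorem KG_nonneg {a' : ℝ} (ha' : 0 ≤ a') : 0 ≤ KG d a a' := by
  obtain ⟨hD0, -, hZ0⟩ := K_nonneg (d := d) ha'
  have hG := Ginv_nonneg d a'
  have hC := Cst_nonneg d a
  unfold KG
  positivity

omit [DecidableEq o] in
/-- `1 ≤ Kmax`. [folklore] -/
theorem one_le_Kmax {a' : ℝ} (ha' : 0 ≤ a') : 1 ≤ Kmax o d a a' := by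
  have hG := KG_nonneg (d := d) (a := a) ha'
  unfold Kmax
  have : (0 : ℝ) ≤ 2 * Fintype.card o * (d + 1) + 2 * (d + 1) * KG d a a' := by positivity
  linarith

omit [DecidableEq o] in
/-- `0 ≤ KstarR`. [folklore] -/
theorem KstarR_nonneg (ha0 : 0 ≤ a) : 0 ≤ KstarR o d a := by
  have hC := Cst_nonneg d a
  unfold KstarR
  positivity

omit [DecidableEq o] in
/-- **THE THRESHOLD IS NOT VACUOUS**: `0 < η⋆`. [folklore] -/
theorem etaStar_pos (ha0 : 0 ≤ a) {a' : ℝ} (ha' : 0 ≤ a') : 0 < etaStar o d a a' := by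
  have h1 : 0 ≤ KB4 d a' := by
    have := KS_nonneg (d := d) ha'; have := (K_nonneg (d := d) ha').2.1; unfold KB4; positivity
  have h2 := one_le_Kmax (o := o) (d := d) (a := a) ha'
  have h3 := KstarR_nonneg (o := o) (d := d) (a := a) ha0
  unfold etaStar
  refine lt_min ?_ ?_ <;> positivity

/-! ## §2 The eight numeric binders of the `t = 1` face from `α, β ≤ η ≤ η⋆` -/

omit [DecidableEq o] in
/-- **THE ARITHMETIC**: for `0 ≤ α ≤ η`, `0 ≤ β ≤ η`, `η ≤ η⋆(card o, d, a, a′)` (`a ≥ 0`, `a′ > 0`), with `τ_R = e^{(d+1)α} − 1` and smallness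
parameter `η′ = η·Kmax`: `kappaS … τ_R < 1`, `σ₀⁻²·δK < 1`, `α, β, epsR o d α, kappa4F d a a′ α β ≤ η′`, `η′ ≤ 1`, `η′·KstarR < 1` — leaf-05's
`gaugeSlot_small_of_le` (B4 half) and leaf-03's `RegularTransportSize` (transport size) assembled. [folklore] -/
theorem smallness_of_le (ha0 : 0 ≤ a) {a' : ℝ} (ha' : 0 < a') {α β η : ℝ} (hα : 0 ≤ α) (hβ : 0 ≤ β) (hαη : α ≤ η) (hβη : β ≤ η)
    (hη : η ≤ etaStar o d a a') :
    kappaS d a' α β (tauR d α) < 1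
      ∧ ((sigma0 d a') ^ 2)⁻¹ * deltaK (gS d a' (kappaS d a' α β (tauR d α))) (1 + tauR d α) (d * α) (tauR d α) a' < 1
      ∧ α ≤ η * Kmax o d a a' ∧ β ≤ η * Kmax o d a a' ∧ epsR o d α ≤ η * Kmax o d a a'
      ∧ kappa4F d a a' α β ≤ η * Kmax o d a a' ∧ η * Kmax o d a a' ≤ 1 ∧ η * Kmax o d a a' * KstarR o d a < 1 := by
  have hη0 : 0 ≤ η := hα.trans hαη
  have hd : (0 : ℝ) ≤ d := Nat.cast_nonneg d
  have hKB4 : 0 ≤ KB4 d a' := by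
    have := KS_nonneg (d := d) ha'.le; have := (K_nonneg (d := d) ha'.le).2.1; unfold KB4; positivity
  have hKG := KG_nonneg (d := d) (a := a) ha'.le
  have hKmax := one_le_Kmax (o := o) (d := d) (a := a) ha'.le
  have hKs := KstarR_nonneg (o := o) (d := d) (a := a) ha0
  have hm : (0 : ℝ) ≤ Fintype.card o := Nat.cast_nonneg _
  -- the two halves of the threshold
  have hA : η * (2 * ((d : ℝ) + 1) * (1 + KB4 d a')) ≤ 1 := by
    have h := hη.trans (min_le_left _ _)
    have hpos : 0 < 2 * ((d : ℝ) + 1) * (1 + KB4 d a') := by positivity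
    rwa [le_div_iff₀ hpos] at h
  have hB : η * (2 * Kmax o d a a' * (KstarR o d a + 1)) ≤ 1 := by
    have h := hη.trans (min_le_right _ _)
    have hpos : 0 < 2 * Kmax o d a a' * (KstarR o d a + 1) := by positivity
    rwa [le_div_iff₀ hpos] at h
  -- the B4 parameter `η′ = 2(d+1)η`
  have hdη : ((d : ℝ) + 1) * η ≤ 1 := by nlinarith
  have hη'1 : 2 * (((d : ℝ) + 1) * η) ≤ 1 := by nlinarith
  have hη'K : 2 * (((d : ℝ) + 1) * η) * KB4 d a' ≤ 1 := by nlinarith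
  have hηη' : η ≤ 2 * (((d : ℝ) + 1) * η) := by nlinarith
  have hτ0 : 0 ≤ tauR d α := exp_mul_sub_one_nonneg d hα
  have hτη' : tauR d α ≤ 2 * (((d : ℝ) + 1) * η) := exp_mul_sub_one_le d hα hαη hdη
  obtain ⟨hκ, hδ, hG⟩ := gaugeSlot_small_of_le (d := d) (a := a) ha' hα (hαη.trans hηη') hβ (hβη.trans hηη') hτ0 hτη' hη'1 hη'K
  -- conversions to `η·Kmax`
  have hηK : η ≤ η * Kmax o d a a' := le_mul_of_one_le_right hη0 hKmax
  have hε : epsR o d α ≤ η * Kmax o d a a' := by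
    have h := card_mul_exp_sub_one_le o d hα hαη hdη
    have h2 : η * (2 * Fintype.card o * (d + 1)) ≤ η * Kmax o d a a' := by
      refine mul_le_mul_of_nonneg_left ?_ hη0
      unfold Kmax; nlinarith
    exact h.trans h2
  have h4 : kappa4F d a a' α β ≤ η * Kmax o d a a' := by
    refine hG.trans ?_
    have : KG d a a' * (2 * (((d : ℝ) + 1) * η)) = η * (2 * (d + 1) * KG d a a') := by ring
    rw [this]
    refine mul_le_mul_of_nonneg_left ?_ hη0
    unfold Kmax; nlinarith
  have hK1 : η * Kmax o d a a' ≤ 1 := by nlinarith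
  have hK2 : η * Kmax o d a a' * KstarR o d a < 1 := by nlinarith
  exact ⟨hκ.trans_lt (by norm_num), hδ.trans_lt (by norm_num), hαη.trans hηK, hβη.trans hηK, hε, h4, hK1, hK2⟩

/-! ## §3 ROOT B at `t = 1` under the single explicit threshold -/

/-- **ROW B7 — ROOT B AT `t = 1` FOR BAŁABAN's TYPED OPERATOR UNDER ONE EXPLICIT SMALL-FIELD THRESHOLD** (`L ≥ 2`, `d ≥ 1`, `a′ > 0`):
for site-based bond transporters `Rg` in row B5's (3.35)-shape class with sizes `α, β ≤ η ≤ η⋆(card o, d, a, a′)` whose coefficient towers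
`{w, Dw}` obey NODE NE3's `LocalRate … C L⁻¹` (BY NAME, OPEN), the lifted King-averaged unit-lattice covariances of
`(Δ_a^{(k)} ⊗ 1 + P_k)⁻¹` — `P` the model of `Δ_a(U) − Δ_a ⊗ 1` (covariant Laplacian + Bałaban's covariant line-sum averaging + gauge term with
site transports along the (1.7) legs) — CONVERGE with rate `L^{−k}`.  Displayed binders: `hreg`, `hNE3`, `0 < a′`, `α ≤ η`, `β ≤ η`,
`η ≤ etaStar o d a a′` — NOTHING ELSE.  Model level (no B0); NOT [B9] (3.23)–(3.26) as printed; NE2 (U1a) is NOT proved by this (c1).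
[cite: Balaban1985BackgroundPropagators, (3.26) p.395, (3.35) p.396 (shapes)] [folklore] -/
theorem balaban_final_rate_of_regular (hL : 2 ≤ L) (hd : 1 ≤ d)
    {Rg : (k : ℕ) → Fin d → (Tor (fine (lev L k) M) → Matrix o o ℂ)}
    {α β : ℝ} (hreg : RegularTransporters L M (liftR L M Rg) α β) {C : ℝ} (hC : 0 ≤ C)
    (hNE3 : LocalRate (bgReadings L M (regClass L M (liftR L M Rg))) C ((L : ℝ)⁻¹)) {a' : ℝ} (ha' : 0 < a')
    {η : ℝ} (hαη : α ≤ η) (hβη : β ≤ η) (hη : η ≤ etaStar o d a a') :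
    TowerLimitRate (fun k => Qlev L M k ⊗ₖ (1 : Matrix o o ℂ)) ((L : ℝ) ^ d)
      (fun k => (calDalev L M a ha k ⊗ₖ (1 : Matrix o o ℂ)
        + balabanPert L M a (liftR L M Rg) (gaugeSlot L M Rg (QuT L M o (siteT L M Rg)) (Q1 L M o) a') k)⁻¹)
      (Cpert (kappaBs o d a α β (a * (epsR o d α * (2 + epsR o d α) * Cst d a)) (kappa4F d a a' α β))
        (2 * d * Cst d a) (CJ d a)
        (C2Bs o d L a α β C
          (a * C2gram (Cst d a) 1 (epsR o d α) (2 * d * Cst d a) (CJ d a) (Cst d a) (CdeltaR o d a α (theta0 d α (betaNE3 o C))))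
          (C4F o d L a a' α β C)) 0 1) ((L : ℝ)⁻¹) := by
  obtain ⟨h1, h2, h3, h4, h5, h6, h7, h8⟩ :=
    smallness_of_le (o := o) (d := d) a ha.le ha' hreg.nonneg.1 hreg.nonneg.2 hαη hβη hη
  exact balaban_final_rate_of_small L M a ha hL hd hreg hC hNE3 ha' h1 h2 h3 h4 h5 h6 h7 h8

end Summit.QuantumFields.BalabanUV.T4Continuum.NE2BalabanThreshold

end
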